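import Summits.BirchSwinnertonDyer.Rank1Residual.X2.CongruenceTransferCoveredShaUnit
import Summits.BirchSwinnertonDyer.Rank1Residual.X2.CongruenceTransferMultiplicativeDerived
import Summits.BirchSwinnertonDyer.Rank1Residual.Iwasawa.RankGrowthLayerZero
import HarnessLib

/-!
# Route G at a NON-SPLIT Eisenstein `3`, the RANK-RELATIVE road: the good congruent relative is closed by
# ROUTE T (rank growth) instead of `Ш`-unit / Castella–Grossi–Skinner (cell `bsd-eis`, seat `bsd-eis-k5-c3` gen 5; THEOREMS ONLY)

HONEST FRAMING (FULL-BSD rank-≤1 programme D-0033, cell `bsd-eis`, `run/shared/lean/pub/bsd-eis/`; rung K5, crux 3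
`MazurMCOnCellB` = stmt-BirchSwinnertonDyer-19033; row A10 non-split). Nothing booked, no label moves. The tree has two
per-pair roads to Mazur's main conjecture at a NON-split multiplicative Eisenstein prime of a target `E₀` from an
`E₀[p]`-congruent GOOD relative `E₀′`: the COVERED road (`X2/CongruenceTransferCoveredNonsplit.lean`, the relative's MC
from Castella–Grossi–Skinner 2025 Thm. A — a preprint-dependent input, token T-EISRG3C) and the `Ш`-UNIT road
(`X2/CongruenceTransferCoveredShaUnit.lean`, k5-c3 g3: relative of analytic rank `0` with `p ∤ #Ш_an`, MC by Greenberg's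
criterion, token T-EISRG3XN). This file adds the RANK road: the relative has Mordell–Weil rank `≥ m` IN THE KERNEL
(RED-pair certificate over `ℚ`, `Literature.two_le_mordellWeilRank_of_redPair`; or rank growth in the cyclotomic layer,
`Iwasawa.LayerRankGEAt`, now kernel-dischargeable by `Iwasawa/LayerOneRankGrowth.lean`) with `λ_an(E₀′) = n′ ≤ m`; then
Mazur's MC at `(E₀′, p)` holds by ROUTE T (`Iwasawa.mazurMainConjecture_of_le_mordellWeilRank` /
`…_of_layerRankGEAt′`: Greenberg Thm. 1.9 `rank E(ℚ_k) ≤ λ`, PROVED in the tree, + Wuthrich 2014 Thm. 16 divisibility +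
the `μ`-part from `μ_an = 0`, `X1.MuPart.muPartAt_of_analyticMuLE_zero`), and the Greenberg–Vatsal transfer with DERIVED
shift (`algebraicInvariantsEq_of_closedRelative_goodOrd_of_facts`) gives `(μ_alg, λ_alg)(E₀)` and the MC / `BSD(E₀,p)` at
the non-split target exactly as in the `Ш`-unit road. Inputs beyond certificates: Wuthrich 2014 Thm. 16 (both forms),
modularity, Tate's uniformisation (A40/A41), the Greenberg–Vatsal §1–§2 statements — ALL REFEREED (⊂ T-EISRG3XN's name
set minus `hW21 hGr hGZK`); NO Castella–Grossi–Skinner / [BSTW] input, no `hr′`, no `hunit′`. Relatives this serves: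
Hesse-pencil members of rank `2` with `λ′_an = 2` (layer `0`; e.g. for the literal cells 92850e1 / 260544g1 / 192576cf1,
k5-c3 g4 search data) and of rank `r′` with `λ′_an = r′ + 2` and a conductor-`9` zero (layer `1`).

References: R. Greenberg, LNM 1716 (1999) Thm. 1.9 (p. 63) [GreenbergLNM1716]; R. Greenberg, V. Vatsal, Invent. Math.
142 (2000) Thm. (1.4), §1 (5)–(7), §2 [GreenbergVatsal2000]; C. Wuthrich, J. London Math. Soc. 89 (2014) Thm. 16
[Wuthrich2014]; W. Stein, C. Wuthrich, Math. Comp. 82 (2013) Thm. 6.1 [SteinWuthrich2013]; J. H. Silverman, AEC (2009)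
VIII.6.7 [SilvermanAEC2009].
-/

noncomputable section

open scoped Classical MatrixGroups ModularForm

open PowerSeries CongruenceSubgroup WeierstrassCurve NumberField IsDedekindDomain
  Literature.NumberTheory.EllipticCurves
  Literature.NumberTheory.EllipticCurves.ModularForms
  Literature.NumberTheory.EllipticCurves.Rank1Residual
  Literature.NumberTheory.EllipticCurves.Rank1Residual.Typed
  Literature.NumberTheory.EllipticCurves.Wuthrich2014
  Literature.NumberTheory.EllipticCurves.SteinWuthrich2013
  Literature.NumberTheory.EllipticCurves.Greenberg1999
  Literature.NumberTheory.EllipticCurves.GreenbergVatsal2000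
  Summit.BirchSwinnertonDyer.BirchSwinnertonDyer.Theorems.Rank1ResidualX1Defs
  Summit.BirchSwinnertonDyer.Rank1Residual.X1.MuLambda
  Summit.BirchSwinnertonDyer.Rank1Residual.X1.MuPart
  Summit.BirchSwinnertonDyer.Rank1Residual.X1.ParitySqueeze
  Summit.BirchSwinnertonDyer.Rank1Residual.X1.TamagawaSqueeze
  Summit.BirchSwinnertonDyer.Rank1Residual.X1.CongruenceTransfer
  Summit.BirchSwinnertonDyer.Rank1Residual.X2.CongruentLambdaShiftMultiplicative
  Summit.BirchSwinnertonDyer.Rank1Residual.Iwasawa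

set_option autoImplicit false

namespace Summit.BirchSwinnertonDyer.Rank1Residual.X2

section RankRelative

variable {W W' : WeierstrassCurve ℚ} [W.IsElliptic] [W.IsGloballyMinimal]
  [W'.IsElliptic] [W'.IsGloballyMinimal] {p : ℕ} [Fact p.Prime]
  (S₀ : Finset (HeightOneSpectrum (𝓞 ℚ)))

/-- **The GOOD relative closed by route T at layer `k`**: `E′` good at `p ≠ 2` with `E′[p]` reducible (hence ordinary),
`μ_an(E′) = 0`, `λ_an(E′) = n′` and a rank-growth certificate `LayerRankGEAt E′ p k m` with `n′ ≤ m` ⟹ Mazur's main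
conjecture at `(E′, p)` (Greenberg Thm. 1.9 + Wuthrich Thm. 16 + the `μ`-part at `μ_an = 0`).
[cite: GreenbergLNM1716, Thm. 1.9 (p. 63)] [cite: Wuthrich2014, Thm. 16 (p. 397)] -/
theorem mazurMainConjecture_relative_of_layerRankGEAt (hW16 : Wuthrich2014.charIdeal_dvd_padicLFunction)
    (hp2 : p ≠ 2) (hgood' : W'.HasGoodReductionAtPrime p) (hred' : ¬ W'.HasIrreducibleModPGaloisRep p)
    {n' k m : ℕ} (hμ0' : X1.MuPart.AnalyticMuLE W' p 0) (hlam' : X1.ParitySqueeze.AnalyticLambdaEq W' p n')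
    (hm' : LayerRankGEAt W' p k m) (hn'm : n' ≤ m) : MazurMainConjecture W' p :=
  have hp : 2 < p := by
    have h2 := (Fact.out : p.Prime).two_le
    omega
  have hord' : ¬ (p : ℤ) ∣ W'.frobeniusTrace p := not_dvd_frobeniusTrace_of_red_of_good W' p hp hgood' hred'
  mazurMainConjecture_of_layerRankGEAt' hW16 hp2 hgood' hord' hred'
    (muPartAt_of_analyticMuLE_zero hW16 hp2 hgood' hord' hred' hμ0') hlam' hm' hn'm

/-- **X2 target, GOOD relative closed by route T ⇒ `(μ_alg, λ_alg)(E₀) = (0, k)`, shift DERIVED.** Target `(E₀, p)`: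
`p ≠ 2` multiplicative, `E₀[p]` reducible, `μ_an(E₀) = 0`. Relative `(E₀′, p)`: GOOD, `μ_an = 0`, `λ_an = n′`,
rank-growth certificate `LayerRankGEAt E₀′ p k′ m` with `n′ ≤ m` (for `k′ = 0`: `m ≤ rank E₀′(ℚ)`,
`Iwasawa.layerRankGEAt_of_le_mordellWeilRank`); congruence `E₀[p] ≅ E₀′[p]`; `Σ₀ ∌ p` off which both are good;
`k = n′ + Σ_{v∈Σ₀}(δ′ − δ) − e_p(E₀)`. [cite: GreenbergVatsal2000, Thm. (1.4), §1 (5)–(7), pp. 14–15, §2 pp. 20–27]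
[cite: Wuthrich2014, Thm. 16 (p. 397)] [cite: GreenbergLNM1716, Thm. 1.9 (p. 63)] -/
theorem algebraicInvariantsEq_of_rankRelative_of_facts
    (hWu : thm16_charIdeal_dvd_multiplicative_of_reducible)
    (hW16 : Wuthrich2014.charIdeal_dvd_padicLFunction)
    (hpar : nonempty_modularParametrizationData)
    (hT : Silverman1994_thmV53_corV54_tateUniformisation.{0})
    (hT' : Silverman1994_thmV53_tateUniformisation.{0})
    (hAm : lambda_nonPrimitive_eq_add_sum_delta_multiplicative)
    (hBm : datumSelmer_divisible_of_finite_torsionBy) (hF : datumStrictSelmer_lt_datumSelmer_of_split)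
    (hGV : imKummer_ge_greenbergCondition_at_p) (hA7 : lambda_nonPrimitive_eq_add_sum_delta)
    (hB : divisible_nonPrimitiveSelmerInfty_of_mu_eq_zero) (hp2 : p ≠ 2)
    (hmult : W.HasMultiplicativeReductionAtPrime p) (hred : ¬ W.HasIrreducibleModPGaloisRep p)
    (hμ0 : AnalyticMuLE W p 0) (hgood' : W'.HasGoodReductionAtPrime p) {n' k' m : ℕ}
    (hμ0' : X1.MuPart.AnalyticMuLE W' p 0) (hlam' : X1.ParitySqueeze.AnalyticLambdaEq W' p n')
    (hm' : LayerRankGEAt W' p k' m) (hn'm : n' ≤ m)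
    (hS₀ : ∀ v ∈ S₀, ((p : ℕ) : 𝓞 ℚ) ∉ v.asIdeal)
    (hS : ∀ v : HeightOneSpectrum (𝓞 ℚ), v ∉ S₀ → ((p : ℕ) : 𝓞 ℚ) ∉ v.asIdeal →
      W.HasGoodReductionAt v)
    (hS' : ∀ v : HeightOneSpectrum (𝓞 ℚ), v ∉ S₀ → ((p : ℕ) : 𝓞 ℚ) ∉ v.asIdeal →
      W'.HasGoodReductionAt v)
    (hiso : TorsionIso W W' p) {k : ℕ}
    (hk : (k : ℤ) = n' + (∑ v ∈ S₀, ((delta W' p v : ℤ) - (delta W p v : ℤ)) -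
      (if W.HasSplitMultiplicativeReductionAtPrime p then 1 else 0))) :
    AlgebraicInvariantsEq W p k :=
  have hp : 2 < p := by
    have h2 := (Fact.out : p.Prime).two_le
    omega
  have hred' : ¬ W'.HasIrreducibleModPGaloisRep p := not_hasIrreducibleModPGaloisRep_of_torsionIso hiso hred
  have hord' : ¬ (p : ℤ) ∣ W'.frobeniusTrace p := not_dvd_frobeniusTrace_of_red_of_good W' p hp hgood' hred'
  algebraicInvariantsEq_of_closedRelative_goodOrd_of_facts S₀ hWu hW16 hpar hT hT' hAm hBm hF hGV hA7 hB hp2 hmult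
    hred hμ0 hgood' hord' hred'
    (mazurMainConjecture_relative_of_layerRankGEAt hW16 hp2 hgood' hred' hμ0' hlam' hm' hn'm) hμ0' hlam' hS₀ hS hS'
    hiso hk

/-- **NON-SPLIT X2 pair, GOOD relative closed by route T, shift DERIVED ⇒ Mazur's main conjecture at the pair**
(both ranks), with NO `hA`, NO `hr′`, NO `hunit′`: `(E₀, p)` non-split multiplicative, `E₀[p]` reducible, `p ≠ 2`,
`μ_an(E₀) = 0`, `λ_an(E₀) = n`; `(E₀′, p)` good, `μ_an = 0`, `λ_an = n′ ≤ m`, `LayerRankGEAt E₀′ p k′ m` (KERNEL: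
rank over `ℚ` by a RED-pair certificate, or over `ℚ_1` by `LayerOneRank`); `E₀[p] ≅ E₀′[p]`; `Σ₀ ∌ p` ⊇ bad primes of
both; and `n ≤ n′ + Σ_{v∈Σ₀}(δ′ − δ)` (then `=`). [cite: Wuthrich2014, Thm. 16 (p. 397)]
[cite: GreenbergLNM1716, Thm. 1.9 (p. 63)] [cite: GreenbergVatsal2000, Thm. (1.4), §1 (5)–(7), pp. 14–15, §2 pp. 20–27] -/
theorem mazurMainConjectureAt_of_rankRelative_of_not_split
    (hWu : thm16_charIdeal_dvd_multiplicative_of_reducible)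
    (hW16 : Wuthrich2014.charIdeal_dvd_padicLFunction)
    (hpar : nonempty_modularParametrizationData)
    (hT : Silverman1994_thmV53_corV54_tateUniformisation.{0})
    (hT' : Silverman1994_thmV53_tateUniformisation.{0})
    (hAm : lambda_nonPrimitive_eq_add_sum_delta_multiplicative)
    (hBm : datumSelmer_divisible_of_finite_torsionBy) (hF : datumStrictSelmer_lt_datumSelmer_of_split)
    (hGV : imKummer_ge_greenbergCondition_at_p) (hA7 : lambda_nonPrimitive_eq_add_sum_delta)
    (hB : divisible_nonPrimitiveSelmerInfty_of_mu_eq_zero) (hp2 : p ≠ 2)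
    (hmult : W.HasMultiplicativeReductionAtPrime p)
    (hns : ¬ W.HasSplitMultiplicativeReductionAtPrime p) (hred : ¬ W.HasIrreducibleModPGaloisRep p)
    {n : ℕ} (hμ0 : AnalyticMuLE W p 0) (hlam : AnalyticLambdaEq W p n)
    (hgood' : W'.HasGoodReductionAtPrime p) {n' k' m : ℕ}
    (hμ0' : X1.MuPart.AnalyticMuLE W' p 0) (hlam' : X1.ParitySqueeze.AnalyticLambdaEq W' p n')
    (hm' : LayerRankGEAt W' p k' m) (hn'm : n' ≤ m)
    (hS₀ : ∀ v ∈ S₀, ((p : ℕ) : 𝓞 ℚ) ∉ v.asIdeal)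
    (hS : ∀ v : HeightOneSpectrum (𝓞 ℚ), v ∉ S₀ → ((p : ℕ) : 𝓞 ℚ) ∉ v.asIdeal →
      W.HasGoodReductionAt v)
    (hS' : ∀ v : HeightOneSpectrum (𝓞 ℚ), v ∉ S₀ → ((p : ℕ) : 𝓞 ℚ) ∉ v.asIdeal →
      W'.HasGoodReductionAt v)
    (hiso : TorsionIso W W' p) {k : ℕ}
    (hk : (k : ℤ) = n' + ∑ v ∈ S₀, ((delta W' p v : ℤ) - (delta W p v : ℤ))) (hn : n ≤ k) :
    X2.MazurMainConjectureAt W p :=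
  mazurMainConjectureAt_of_algebraicInvariantsEq hWu W p hp2 hmult hred hμ0 hlam
    (algebraicInvariantsEq_of_rankRelative_of_facts S₀ hWu hW16 hpar hT hT' hAm hBm hF hGV hA7 hB hp2 hmult hred hμ0
      hgood' hμ0' hlam' hm' hn'm hS₀ hS hS' hiso (by rw [if_neg hns, sub_zero]; exact hk))
    (fun _ ↦ hn) (fun h ↦ absurd h hns)

/-- **NON-SPLIT X2b pair (rank `0`), GOOD relative closed by route T, shift DERIVED ⇒ `BSD(E₀, p)`**, with NO
`hA`/`hr′`/`hunit′`; last step = `bsdp_of_mazurMainConjectureAt_of_analyticRank_eq_zero` (Stein–Wuthrich Thm. 6.1,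
Greenberg–Stevens, GZK, modularity). [cite: Wuthrich2014, Thm. 16 (p. 397)] [cite: GreenbergLNM1716, Thm. 1.9 (p. 63)]
[cite: GreenbergVatsal2000, Thm. (1.4), §2 pp. 20–27] [cite: SteinWuthrich2013, Thm. 6.1 (p. 20)] -/
theorem bsdp_of_rankRelative_rankZero_of_not_split
    (hWu : thm16_charIdeal_dvd_multiplicative_of_reducible)
    (hW16 : Wuthrich2014.charIdeal_dvd_padicLFunction)
    (hJs : thm61_splitMultiplicative) (hJn : thm61_nonsplitMultiplicative)
    (hHs : exists_isSplitMultCanonical) (hHn : exists_isMultCanonical)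
    (hGZK : rank_eq_analyticRank_of_analyticRank_le_one) (hmod : hasEntireLFunction_rat)
    (hpar : nonempty_modularParametrizationData)
    (hT : Silverman1994_thmV53_corV54_tateUniformisation.{0})
    (hT' : Silverman1994_thmV53_tateUniformisation.{0})
    (hAm : lambda_nonPrimitive_eq_add_sum_delta_multiplicative)
    (hBm : datumSelmer_divisible_of_finite_torsionBy) (hF : datumStrictSelmer_lt_datumSelmer_of_split)
    (hGV : imKummer_ge_greenbergCondition_at_p) (hA7 : lambda_nonPrimitive_eq_add_sum_delta)
    (hB : divisible_nonPrimitiveSelmerInfty_of_mu_eq_zero)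
    (W W' : WeierstrassCurve ℚ) [W.IsElliptic] [W.IsGloballyMinimal] [W'.IsElliptic]
    [W'.IsGloballyMinimal] (p : ℕ) [Fact p.Prime] (hGS : greenberg_stevens (W := W) (p := p))
    (hp2 : p ≠ 2) (hmult : W.HasMultiplicativeReductionAtPrime p)
    (hns : ¬ W.HasSplitMultiplicativeReductionAtPrime p)
    (hred : ¬ W.HasIrreducibleModPGaloisRep p) (hr : W.analyticRank = 0) {n : ℕ}
    (hμ0 : AnalyticMuLE W p 0) (hlam : AnalyticLambdaEq W p n)
    (hgood' : W'.HasGoodReductionAtPrime p) {n' k' m : ℕ}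
    (hμ0' : X1.MuPart.AnalyticMuLE W' p 0) (hlam' : X1.ParitySqueeze.AnalyticLambdaEq W' p n')
    (hm' : LayerRankGEAt W' p k' m) (hn'm : n' ≤ m)
    (hS₀ : ∀ v ∈ S₀, ((p : ℕ) : 𝓞 ℚ) ∉ v.asIdeal)
    (hS : ∀ v : HeightOneSpectrum (𝓞 ℚ), v ∉ S₀ → ((p : ℕ) : 𝓞 ℚ) ∉ v.asIdeal →
      W.HasGoodReductionAt v)
    (hS' : ∀ v : HeightOneSpectrum (𝓞 ℚ), v ∉ S₀ → ((p : ℕ) : 𝓞 ℚ) ∉ v.asIdeal →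
      W'.HasGoodReductionAt v)
    (hiso : TorsionIso W W' p) {k : ℕ}
    (hk : (k : ℤ) = n' + ∑ v ∈ S₀, ((delta W' p v : ℤ) - (delta W p v : ℤ))) (hn : n ≤ k) :
    BSDp W p :=
  bsdp_of_mazurMainConjectureAt_of_analyticRank_eq_zero hJs hJn hHs hHn hGZK hmod hpar W p hGS hp2
    hmult hr (mazurMainConjectureAt_of_rankRelative_of_not_split S₀ hWu hW16 hpar hT hT' hAm hBm hF hGV hA7 hB hp2
      hmult hns hred hμ0 hlam hgood' hμ0' hlam' hm' hn'm hS₀ hS hS' hiso hk hn)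

end RankRelative

end Summit.BirchSwinnertonDyer.Rank1Residual.X2

end
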